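import Summits.AtomisticToContinuum.Crystallization.Theorems.PricedLinkCensusTruncatedCensusGapStrainedLinkDictionary
import Summits.AtomisticToContinuum.Crystallization.Theorems.PricedLinkCensusTruncatedCensusGapRatioGermEngine
import Summits.AtomisticToContinuum.Crystallization.Theorems.PricedLinkCensusTruncatedCensusGapElasticBasinSplit

/-!
# THRESH holds: a charged near₂ site deviates (line `elastic-basin-split`, crux `TruncatedCensusGap`)

The registered stub `stub_chargedNearSiteDeviates` (THRESH) of strategist s3's line
`Cruxes/TruncatedCensusGap/Lines/elastic_basin_split.lean` for the crux
`PricedLinkCensus.TruncatedCensusGap` (item stmt-AtomisticToContinuum-14230), reshaped by lead c6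
(r1) into T1 `stub_strainedLinkDictionary` (landed, p173403) and T2 `stub_ratioGermEngine` (landed,
p173397) with the glue `chargedNearSiteDeviates_of` (landed in `…ElasticBasinSplit.lean`, p173395),
is now a THEOREM: `chargedNearSiteDeviates_holds`, the registered THRESH signature verbatim.

Statement (a₀ = 977/1000, δ = a₀/5000): for an injective configuration `y`, a site `i`, a Hägg word
`s`, a linear `F` with `‖F v − a₀ v‖ ≤ (a₀/10)‖v‖` and a rigid motion `g` such that the sites within
`3a₀` of `y i` are `a₀/2`-separated and two-way `a₀/8`-matched to `g (F (barlowStacking 1 √(2/3) s))`,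
if `i` is CHARGED at tolerance `1/100` then EITHER some reference point within `5a₀/2` of `y i` has two
ideal bonds whose strained lengths are split beyond the ratio `2007/2000`, OR some site within `5a₀/2`
of `y i` is at distance `≥ δ` from every reference point.  (Contrapositive: `δ`-closeness to a
window-conformal strained stacking forces twelve bonds with all ring numbers four; margin
`1.0035² + 4.03·δ/m ≈ 1.0079 < 1.01`.)
-/

noncomputable section

namespace Summit.AtomisticToContinuum.Crystallization.Theorems.PricedLinkCensusTruncatedCensusGap

/-- **THRESH (`ChargedNearSiteDeviates`) holds**: a charged near₂ site has a window-bad reference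
point or an `a₀/5000`-deviating site within `5a₀/2` — T1 (strained link dictionary) and T2 (ratio
germ engine) fed into the glue `chargedNearSiteDeviates_of`. [folklore] -/
theorem chargedNearSiteDeviates_holds :
    ∀ (N : ℕ) (y : Fin N → EuclideanSpace ℝ (Fin 3)), Function.Injective y → ∀ (i : Fin N) (s : ℤ → ℤ) (F : EuclideanSpace ℝ (Fin 3) →L[ℝ] EuclideanSpace ℝ (Fin 3)) (g : EuclideanSpace ℝ (Fin 3) ≃ᵃⁱ[ℝ] EuclideanSpace ℝ (Fin 3)), Literature.MathematicalPhysics.StatisticalMechanics.IsHaggSeq s → (∀ v : EuclideanSpace ℝ (Fin 3), ‖F v - (977 / 1000 : ℝ) • v‖ ≤ 977 / 10000 * ‖v‖) → (∀ j k : Fin N, j ≠ k → dist (y j) (y i) ≤ 2931 / 1000 → 977 / 2000 ≤ dist (y j) (y k)) → (∀ j : Fin N, dist (y j) (y i) ≤ 2931 / 1000 → ∃ z ∈ Literature.MathematicalPhysics.StatisticalMechanics.barlowStacking 1 (Real.sqrt (2 / 3)) s, dist (y j) (g (F z)) ≤ 977 / 8000) → (∀ z ∈ Literature.MathematicalPhysics.StatisticalMechanics.barlowStacking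 1 (Real.sqrt (2 / 3)) s, dist (g (F z)) (y i) ≤ 2931 / 1000 → ∃ j : Fin N, dist (y j) (g (F z)) ≤ 977 / 8000) → ¬ Literature.Geometry.DiscreteGeometry.IsChargeFree (1 / 100 : ℝ) y i → (∃ z₀ ∈ Literature.MathematicalPhysics.StatisticalMechanics.barlowStacking 1 (Real.sqrt (2 / 3)) s, ∃ z ∈ Literature.MathematicalPhysics.StatisticalMechanics.barlowStacking 1 (Real.sqrt (2 / 3)) s, ∃ z' ∈ Literature.MathematicalPhysics.StatisticalMechanics.barlowStacking 1 (Real.sqrt (2 / 3)) s, dist (g (F z₀)) (y i) ≤ 4885 / 2000 ∧ dist z z₀ = 1 ∧ dist z' z₀ = 1 ∧ (2007 / 2000 : ℝ) * ‖F (z' - z₀)‖ < ‖F (z - z₀)‖) ∨ (∃ j : Fin N, dist (y j) (y i) ≤ 4885 / 2000 ∧ ∀ z ∈ Literature.MathematicalPhysics.StatisticalMechanics.barlowStacking 1 (Real.sqrt (2 / 3)) s, (977 / 5000000 : ℝ) ≤ dist (y j) (g (F z))) :=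
  chargedNearSiteDeviates_of stub_strainedLinkDictionary stub_ratioGermEngine

end Summit.AtomisticToContinuum.Crystallization.Theorems.PricedLinkCensusTruncatedCensusGap

end
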